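import Literature.Probability.Percolation.PercolationProofs
import HarnessLib

/-!
# Newman–Tassion–Wu 2017, proof of Theorem 2.4 — the renewal step ("comparison to a sequence of i.i.d. trials")

Topic: `Literature/Probability/Percolation`. The last paragraph of the proof of NTW's main theorem (the minimal spanning
forest of a slab is a single tree), arXiv:1512.09107 p. 19, runs: with `𝓩^i = 𝓑_0^{m_i} ∩ 𝓑_x^{m_i} ∩ C_{n_i,2n_i}`,

> Since `𝓩^{i-1}` is measurable with respect to the state of edges in `B̄_{m_{i-1}}`, for all `i` sufficiently large,
> `ℙ[𝓩^i | (𝓩^{i₀})^c, (𝓩^{i₀+1})^c, …, (𝓩^{i-1})^c] ≥ c₁`. It then follows by comparison to a sequence of i.i.d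
> trials with success probability `c₁` that `ℙ(𝓑_0^{m_i}, 𝓑_x^{m_i}, C_{n_i,2n_i} i.o.) = 1`.

the input being the consequence of the gluing Lemma 4.1: `ℙ[𝓑_0^{m_i}, 𝓑_x^{m_i}, 𝓨_A^i] ≥ c₁ ℙ[A]` for EVERY event `A`
measurable with respect to the edges of `B̄_{m_{i-1}}`.  This file is the measure-theoretic content of that paragraph, for an
arbitrary finite measure and an increasing sequence of sub-σ-algebras `𝓕 i` (on the slab: `𝓕 i` = the σ-algebra of the labels
of the edges touching `B̄_{m_i}`):

* `NTW17.measureReal_biInter_compl_le_pow` — if `Z i` is `𝓕 i`-measurable and `c · ℙ[A] ≤ ℙ[Z i ∩ A]` for all `i > i₀` and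
  all `𝓕 (i-1)`-measurable `A`, then `ℙ[⋂_{i₀ < j ≤ i₀+n} (Z j)ᶜ] ≤ (1 - c)^n · ℙ[Ω]`;
* `NTW17.measure_forall_not_mem_eq_zero`, `NTW17.ae_exists_mem` — hence, for `c > 0`, almost surely some `Z j`, `j > i₀`,
  occurs (indeed infinitely many, `NTW17.ae_frequently_mem`, since the hypothesis persists for every larger `i₀`);
* `NTW17.measurableSet_comap_restrict_iff` — on the label space `Sym2 V → ℝ` the `𝓕`-measurable sets for
  `𝓕 = σ(U e : e ∈ F)` are exactly the events "read off the labels of `F`" in the form used by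
  `GrimmettMarstrand1990.labelMeasure_real_inter_preimage_eq_mul` (preimages of measurable sets under `U ↦ (U e)_{e ∈ F}`),
  and `NTW17.comap_restrict_mono` — these σ-algebras increase with `F`.

## Sources

* C. M. Newman, V. Tassion, W. Wu, *Critical percolation and the minimal spanning tree in slabs*, Comm. Pure Appl. Math. 70
  (2017), arXiv:1512.09107: §4, proof of Theorem 2.4 (p. 19) [NewmanTassionWu2017].
-/

noncomputable section

namespace Literature.Probability.Percolation

open _root_.MeasureTheory Set Filter
open scoped ENNReal

namespace NTW17

/-! ## Comparison with i.i.d. trials along an increasing sequence of σ-algebras -/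

section Renewal

variable {Ω : Type*} {m : MeasurableSpace Ω} {μ : Measure Ω} [IsFiniteMeasure μ]
  {𝓕 : ℕ → MeasurableSpace Ω} {Z : ℕ → Set Ω} {c : ℝ} {i₀ : ℕ}

/-- The events "no success at the trials `i₀ < j ≤ i₀ + n`" are `𝓕 (i₀ + n)`-measurable when each `Z j` is
`𝓕 j`-measurable and `𝓕` increases ("`𝓩^{i-1}` is measurable with respect to the state of edges in `B̄_{m_{i-1}}`").
[cite: NewmanTassionWu2017, §4 (proof of Theorem 2.4, p. 19)] -/
theorem measurableSet_biInter_compl (h𝓕 : Monotone 𝓕) (hZ : ∀ i, MeasurableSet[𝓕 i] (Z i)) (n : ℕ) :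
    MeasurableSet[𝓕 (i₀ + n)] (⋂ j ∈ Finset.Ioc i₀ (i₀ + n), (Z j)ᶜ) := by
  refine Finset.measurableSet_biInter _ fun j hj => ?_
  have hj' : j ≤ i₀ + n := (Finset.mem_Ioc.1 hj).2
  exact (h𝓕 hj' _ (hZ j)).compl

/-- **Comparison with i.i.d. trials** (geometric bound). Let `𝓕 0 ≤ 𝓕 1 ≤ …` be sub-σ-algebras, `Z i` an `𝓕 i`-measurable
event, and suppose the conditional success bound `c · ℙ[A] ≤ ℙ[Z i ∩ A]` for every `i > i₀` and every `𝓕 (i-1)`-measurable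
`A`.  Then `ℙ[⋂_{i₀ < j ≤ i₀ + n} (Z j)ᶜ] ≤ (1 - c)^n · ℙ[Ω]`.
[cite: NewmanTassionWu2017, §4 (proof of Theorem 2.4, p. 19)] -/
theorem measureReal_biInter_compl_le_pow (h𝓕 : Monotone 𝓕) (h𝓕le : ∀ i, 𝓕 i ≤ m)
    (hZ : ∀ i, MeasurableSet[𝓕 i] (Z i))
    (hglue : ∀ i, i₀ < i → ∀ A : Set Ω, MeasurableSet[𝓕 (i - 1)] A → c * μ.real A ≤ μ.real (Z i ∩ A)) (n : ℕ) :
    μ.real (⋂ j ∈ Finset.Ioc i₀ (i₀ + n), (Z j)ᶜ) ≤ (1 - c) ^ n * μ.real univ := by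
  -- either the measure vanishes, or `c ≤ 1`
  rcases eq_or_lt_of_le (measureReal_nonneg : 0 ≤ μ.real univ) with h0 | hpos
  · have hzero : ∀ s : Set Ω, μ.real s = 0 := fun s =>
      le_antisymm ((measureReal_mono (subset_univ s)).trans h0.symm.le) measureReal_nonneg
    rw [hzero, hzero, mul_zero]
  have hc1 : c ≤ 1 := by
    have h := hglue (i₀ + 1) (Nat.lt_succ_self _) univ MeasurableSet.univ
    rw [inter_univ] at h
    have h' : μ.real (Z (i₀ + 1)) ≤ μ.real univ := measureReal_mono (subset_univ _)
    nlinarith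
  induction n with
  | zero => simp
  | succ n ih =>
    -- `A_{n+1} = A_n ∖ Z_{i₀+n+1}` with `A_n` `𝓕 (i₀+n)`-measurable
    set A := ⋂ j ∈ Finset.Ioc i₀ (i₀ + n), (Z j)ᶜ with hA
    have hAm : MeasurableSet[𝓕 (i₀ + n)] A := measurableSet_biInter_compl h𝓕 hZ n
    have hstep : (⋂ j ∈ Finset.Ioc i₀ (i₀ + (n + 1)), (Z j)ᶜ) = A \ Z (i₀ + n + 1) := by
      rw [← add_assoc, ← Finset.insert_Ioc_right_eq_Ioc_add_one (by omega : i₀ ≤ i₀ + n),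
        Finset.set_biInter_insert, Set.sdiff_eq, inter_comm]
    have hZm : MeasurableSet (Z (i₀ + n + 1)) := h𝓕le _ _ (hZ _)
    have hsplit := measureReal_inter_add_sdiff (μ := μ) (s := A) hZm
    have hg := hglue (i₀ + n + 1) (by omega) A (by rw [Nat.add_sub_cancel]; exact hAm)
    rw [inter_comm] at hg
    rw [hstep]
    calc μ.real (A \ Z (i₀ + n + 1)) = μ.real A - μ.real (A ∩ Z (i₀ + n + 1)) := by linarith
      _ ≤ (1 - c) * μ.real A := by linarith
      _ ≤ (1 - c) * ((1 - c) ^ n * μ.real univ) := mul_le_mul_of_nonneg_left ih (by linarith)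
      _ = (1 - c) ^ (n + 1) * μ.real univ := by ring

/-- **No success ever has probability zero**: under the hypotheses of `measureReal_biInter_compl_le_pow` with `c > 0`,
`ℙ[∀ j > i₀, ω ∉ Z j] = 0`. [cite: NewmanTassionWu2017, §4 (proof of Theorem 2.4, p. 19)] -/
theorem measure_forall_not_mem_eq_zero (h𝓕 : Monotone 𝓕) (h𝓕le : ∀ i, 𝓕 i ≤ m)
    (hZ : ∀ i, MeasurableSet[𝓕 i] (Z i)) (hc : 0 < c)
    (hglue : ∀ i, i₀ < i → ∀ A : Set Ω, MeasurableSet[𝓕 (i - 1)] A → c * μ.real A ≤ μ.real (Z i ∩ A)) :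
    μ {ω | ∀ j, i₀ < j → ω ∉ Z j} = 0 := by
  set S := {ω | ∀ j, i₀ < j → ω ∉ Z j} with hS
  have hsub : ∀ n, S ⊆ ⋂ j ∈ Finset.Ioc i₀ (i₀ + n), (Z j)ᶜ := by
    intro n ω hω
    simp only [mem_iInter, mem_compl_iff]
    exact fun j hj => hω j (Finset.mem_Ioc.1 hj).1
  have hc1 : c ≤ 1 ∨ μ.real univ = 0 := by
    rcases eq_or_lt_of_le (measureReal_nonneg : 0 ≤ μ.real univ) with h0 | hpos
    · exact Or.inr h0.symm
    · left
      have h := hglue (i₀ + 1) (Nat.lt_succ_self _) univ MeasurableSet.univ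
      rw [inter_univ] at h
      have h' : μ.real (Z (i₀ + 1)) ≤ μ.real univ := measureReal_mono (subset_univ _)
      nlinarith
  have hle : ∀ n, μ.real S ≤ (1 - c) ^ n * μ.real univ := fun n =>
    (measureReal_mono (hsub n)).trans (measureReal_biInter_compl_le_pow h𝓕 h𝓕le hZ hglue n)
  have hreal : μ.real S = 0 := by
    refine le_antisymm ?_ measureReal_nonneg
    rcases hc1 with hc1 | h0
    · have hlim : Tendsto (fun n => (1 - c) ^ n * μ.real univ) atTop (nhds (0 * μ.real univ)) :=
        (tendsto_pow_atTop_nhds_zero_of_lt_one (by linarith) (by linarith)).mul_const _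
      rw [zero_mul] at hlim
      exact ge_of_tendsto' hlim hle
    · have := hle 0
      rw [h0, mul_zero] at this
      exact this
  exact (measureReal_eq_zero_iff (measure_ne_top μ S)).1 hreal

/-- **Almost surely some trial succeeds**: `∀ᵐ ω, ∃ j > i₀, ω ∈ Z j` ("`ℙ(𝓑_0^{m_i}, 𝓑_x^{m_i}, C_{n_i,2n_i}` for some
`i`) `= 1`", which is all the single-tree argument uses). [cite: NewmanTassionWu2017, §4 (proof of Theorem 2.4, p. 19)] -/
theorem ae_exists_mem (h𝓕 : Monotone 𝓕) (h𝓕le : ∀ i, 𝓕 i ≤ m) (hZ : ∀ i, MeasurableSet[𝓕 i] (Z i))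
    (hc : 0 < c)
    (hglue : ∀ i, i₀ < i → ∀ A : Set Ω, MeasurableSet[𝓕 (i - 1)] A → c * μ.real A ≤ μ.real (Z i ∩ A)) :
    ∀ᵐ ω ∂μ, ∃ j, i₀ < j ∧ ω ∈ Z j := by
  rw [ae_iff]
  have : {ω | ¬ ∃ j, i₀ < j ∧ ω ∈ Z j} = {ω | ∀ j, i₀ < j → ω ∉ Z j} := by
    ext ω; simp
  rw [this]
  exact measure_forall_not_mem_eq_zero h𝓕 h𝓕le hZ hc hglue

/-- **Almost surely infinitely many trials succeed** ("i.o."), when the conditional success bound holds beyond EVERY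
`i₀' ≥ i₀`. [cite: NewmanTassionWu2017, §4 (proof of Theorem 2.4, p. 19)] -/
theorem ae_frequently_mem (h𝓕 : Monotone 𝓕) (h𝓕le : ∀ i, 𝓕 i ≤ m) (hZ : ∀ i, MeasurableSet[𝓕 i] (Z i))
    (hc : 0 < c)
    (hglue : ∀ i, i₀ < i → ∀ A : Set Ω, MeasurableSet[𝓕 (i - 1)] A → c * μ.real A ≤ μ.real (Z i ∩ A)) :
    ∀ᵐ ω ∂μ, ∃ᶠ j in atTop, ω ∈ Z j := by
  have h' : ∀ᵐ ω ∂μ, ∀ i₁, i₀ ≤ i₁ → ∃ j, i₁ < j ∧ ω ∈ Z j := by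
    rw [ae_all_iff]
    intro i₁
    by_cases hi₁ : i₀ ≤ i₁
    · filter_upwards [ae_exists_mem h𝓕 h𝓕le hZ hc
        (fun i hi A hA => hglue i (lt_of_le_of_lt hi₁ hi) A hA)] with ω hω
      exact fun _ => hω
    · exact ae_of_all _ fun ω h => absurd h hi₁
  filter_upwards [h'] with ω hω
  rw [Filter.frequently_atTop]
  intro a
  obtain ⟨j, hj, hjZ⟩ := hω (max a i₀) (le_max_right _ _)
  exact ⟨j, (le_max_left a i₀).trans hj.le, hjZ⟩

end Renewal

/-! ## The σ-algebras of finitely many labels -/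

section Labels

variable {V : Type*}

/-- On the label space `Sym2 V → ℝ`, the events measurable for `σ(U e : e ∈ F)` (the pull-back σ-algebra under
`U ↦ (U e)_{e ∈ F}`) are exactly the preimages of measurable sets of `F → ℝ` — the form "read off the labels of `F`" of
`GrimmettMarstrand1990.labelMeasure_real_inter_preimage_eq_mul` ("measurable with respect to the state of edges in
`B̄_{m_{i-1}}`"). [cite: NewmanTassionWu2017, §4 (proof of Theorem 2.4, p. 19)] -/
theorem measurableSet_comap_restrict_iff (F : Finset (Sym2 V)) (A : Set (Sym2 V → ℝ)) :
    MeasurableSet[MeasurableSpace.comap (fun (U : Sym2 V → ℝ) (e : F) => U e) inferInstance] A ↔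
      ∃ s : Set (F → ℝ), MeasurableSet s ∧ (fun (U : Sym2 V → ℝ) (e : F) => U e) ⁻¹' s = A :=
  MeasurableSpace.measurableSet_comap

/-- `σ(U e : e ∈ F)` is a sub-σ-algebra of the product σ-algebra of the label space.
[cite: NewmanTassionWu2017, §4 (proof of Theorem 2.4, p. 19)] -/
theorem comap_restrict_le (F : Finset (Sym2 V)) :
    MeasurableSpace.comap (fun (U : Sym2 V → ℝ) (e : F) => U e) inferInstance ≤
      (inferInstance : MeasurableSpace (Sym2 V → ℝ)) := by
  have h : Measurable (fun (U : Sym2 V → ℝ) (e : F) => U e) :=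
    measurable_pi_lambda _ fun e => measurable_pi_apply (e : Sym2 V)
  exact h.comap_le

/-- The σ-algebras `σ(U e : e ∈ F)` increase with `F` (the boxes `B̄_{m_i}` increase with `i`).
[cite: NewmanTassionWu2017, §4 (proof of Theorem 2.4, p. 19)] -/
theorem comap_restrict_mono {F F' : Finset (Sym2 V)} (h : F ⊆ F') :
    MeasurableSpace.comap (fun (U : Sym2 V → ℝ) (e : F) => U e) inferInstance ≤
      MeasurableSpace.comap (fun (U : Sym2 V → ℝ) (e : F') => U e) inferInstance := by
  have hρ : Measurable (fun (W : F' → ℝ) (e : F) => W ⟨e, h e.2⟩) :=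
    measurable_pi_lambda _ fun e => measurable_pi_apply _
  have hcomp : (fun (U : Sym2 V → ℝ) (e : F) => U e) =
      (fun (W : F' → ℝ) (e : F) => W ⟨e, h e.2⟩) ∘ (fun (U : Sym2 V → ℝ) (e : F') => U e) := rfl
  rw [hcomp, ← MeasurableSpace.comap_comp]
  exact MeasurableSpace.comap_mono hρ.comap_le

/-- **The renewal step on the label space.** Let `F 0 ⊆ F 1 ⊆ …` be finite sets of edges, `Z i` an event read off the
labels of `F i`, and suppose `c · ℙ[A] ≤ ℙ[Z i ∩ A]` for every `i > i₀` and every event `A` read off the labels of `F (i-1)`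
(`A = (U ↦ (U e)_{e ∈ F (i-1)})⁻¹' s`, `s` measurable), with `c > 0`.  Then `labelMeasure`-almost surely `Z j` occurs for some
(indeed infinitely many) `j > i₀`. [cite: NewmanTassionWu2017, §4 (proof of Theorem 2.4, p. 19)] -/
theorem ae_frequently_mem_labelMeasure (F : ℕ → Finset (Sym2 V)) (hF : Monotone F) (Z : ℕ → Set (Sym2 V → ℝ))
    (hZ : ∀ i, ∃ s : Set (F i → ℝ), MeasurableSet s ∧ (fun (U : Sym2 V → ℝ) (e : F i) => U e) ⁻¹' s = Z i)
    {c : ℝ} (hc : 0 < c) {i₀ : ℕ}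
    (hglue : ∀ i, i₀ < i → ∀ s : Set (F (i - 1) → ℝ), MeasurableSet s →
      c * (labelMeasure V).real ((fun (U : Sym2 V → ℝ) (e : F (i - 1)) => U e) ⁻¹' s) ≤
        (labelMeasure V).real (Z i ∩ (fun (U : Sym2 V → ℝ) (e : F (i - 1)) => U e) ⁻¹' s)) :
    ∀ᵐ U ∂(labelMeasure V), ∃ᶠ j in atTop, U ∈ Z j := by
  have hprob := isProbabilityMeasure_labelMeasure V
  set 𝓕 : ℕ → MeasurableSpace (Sym2 V → ℝ) :=
    fun i => MeasurableSpace.comap (fun (U : Sym2 V → ℝ) (e : F i) => U e) inferInstance with h𝓕def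
  have h𝓕 : Monotone 𝓕 := fun i j hij => comap_restrict_mono (hF hij)
  have h𝓕le : ∀ i, 𝓕 i ≤ (inferInstance : MeasurableSpace (Sym2 V → ℝ)) := fun i => comap_restrict_le (F i)
  have hZ' : ∀ i, MeasurableSet[𝓕 i] (Z i) := fun i => (measurableSet_comap_restrict_iff (F i) (Z i)).2 (hZ i)
  refine ae_frequently_mem (i₀ := i₀) h𝓕 h𝓕le hZ' hc fun i hi A hA => ?_
  obtain ⟨s, hs, rfl⟩ := (measurableSet_comap_restrict_iff (F (i - 1)) A).1 hA
  exact hglue i hi s hs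

/-- **Determined events are `σ(F)`-measurable.** A measurable event `A` of the label space that is DETERMINED by the labels of
the finite set `F` (two label fields agreeing on `F` lie in `A` together) is measurable for `σ(U e : e ∈ F)` — the bridge from the
locality lemmas of the invasion / circuit layers ("`𝓩^{i-1}` is measurable with respect to the state of edges in `B̄_{m_{i-1}}`") to
the sub-σ-algebras of `ae_frequently_mem_labelMeasure`: `A` is the preimage, under restriction to `F`, of the preimage of `A` under
the measurable extension-by-`0` map `(F → ℝ) → (Sym2 V → ℝ)`. [cite: NewmanTassionWu2017, §4 (proof of Theorem 2.4, p. 19)] -/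
theorem measurableSet_comap_restrict_of_determined (F : Finset (Sym2 V)) {A : Set (Sym2 V → ℝ)} (hA : MeasurableSet A)
    (hdet : ∀ U U' : Sym2 V → ℝ, (∀ e ∈ F, U e = U' e) → U ∈ A → U' ∈ A) :
    MeasurableSet[MeasurableSpace.comap (fun (U : Sym2 V → ℝ) (e : F) => U e) inferInstance] A := by
  classical
  let ext : (F → ℝ) → (Sym2 V → ℝ) := fun w e => if h : e ∈ F then w ⟨e, h⟩ else 0
  have hext : Measurable ext := by
    refine measurable_pi_lambda _ fun e => ?_
    by_cases h : e ∈ F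
    · simp only [ext, h, dif_pos]
      exact measurable_pi_apply _
    · simp only [ext, h, dif_neg, not_false_eq_true]
      exact measurable_const
  refine (measurableSet_comap_restrict_iff F A).2 ⟨ext ⁻¹' A, hA.preimage hext, ?_⟩
  ext U
  simp only [Set.mem_preimage]
  have hagree : ∀ e ∈ F, ext (fun e : F => U e) e = U e := fun e he => by simp [ext, he]
  exact ⟨fun h => hdet _ _ hagree h, fun h => hdet _ _ (fun e he => (hagree e he).symm) h⟩

/-- The events "read off the labels of `F`" as preimages, from determinedness: a measurable `A` determined by the labels of `F`
is `(U ↦ (U e)_{e ∈ F})⁻¹' s` for a measurable `s` — the hypothesis shape of `ae_frequently_mem_labelMeasure` and of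
`GrimmettMarstrand1990.labelMeasure_real_inter_preimage_eq_mul`. [cite: NewmanTassionWu2017, §4 (proof of Theorem 2.4, p. 19)] -/
theorem exists_preimage_restrict_eq_of_determined (F : Finset (Sym2 V)) {A : Set (Sym2 V → ℝ)} (hA : MeasurableSet A)
    (hdet : ∀ U U' : Sym2 V → ℝ, (∀ e ∈ F, U e = U' e) → U ∈ A → U' ∈ A) :
    ∃ s : Set (F → ℝ), MeasurableSet s ∧ (fun (U : Sym2 V → ℝ) (e : F) => U e) ⁻¹' s = A :=
  (measurableSet_comap_restrict_iff F A).1 (measurableSet_comap_restrict_of_determined F hA hdet)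

end Labels

end NTW17

end Literature.Probability.Percolation
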